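import Summits.KontsevichZagierPeriods.Zeta5Search.TwoTaleOmega.FormalBarnes

/-!
# Formal Barnes functionals IV — uniqueness of partial-fraction data (cell `pub-zeta5`, fam-tele gen 4)

HONEST FRAMING: systematic search; no irrationality claim unless certified.

OUR infrastructure (Summit side), blueprint `families/tele/RECURRENCE.md §13.3 (Lemma U)`.  Partial-fraction data are
determined by the rational function they represent: if `v : PF` evaluates to `0` at every `t` off the (finite) pole
set, then `v.poly = 0`, `v.simple = 0`, `v.double = 0` (`PF.eq_zero_of_eval_eq_zero`); hence two data with the same
values off a finite set coincide componentwise (`PF.eq_of_eval_eq`).  This is the bridge from the cert lanes' POLYNOMIAL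
identities (functions; `Certificates/PolyKronecker6`) to identities of DATA, on which the formal functional acts
(`FormalBarnes.lam•_telescope`).  Proof: clear denominators with `D = Π_{k∈S}(X+k)`; the polynomial
`F = poly·D² + Σ α_k (X+k)·Π_{j≠k}(X+j)² + Σ β_k Π_{j≠k}(X+j)²` has infinitely many roots, so `F = 0`; evaluating at
`−k₀` kills everything but `β_{k₀}·Π_{j≠k₀}(j−k₀)²`, so `β = 0`; then `G·D = F` with `G = poly·D + Σ α_k Π_{j≠k}(X+j)`
gives `G = 0`, evaluating at `−k₀` gives `α = 0`, and finally `poly·D = 0`.  Finite algebra only.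
-/

noncomputable section

open Polynomial Finset

namespace Summit.KontsevichZagierPeriods.Zeta5Search.FormalBarnes

variable (S : Finset ℤ)

/-- The linear factor `X + k`. -/
def lin (k : ℤ) : ℚ[X] := X + C (k : ℚ)

/-- The full denominator `D = Π_{k ∈ S} (X + k)`. -/
def DP : ℚ[X] := ∏ j ∈ S, lin j

/-- The complementary product `Π_{j ∈ S, j ≠ k} (X + j)`. -/
def coP (k : ℤ) : ℚ[X] := ∏ j ∈ S.erase k, lin j

/-- Evaluation of the linear factor `X + k` at `t` is `t + k`. -/
theorem eval_lin (k : ℤ) (t : ℚ) : (lin k).eval t = t + k := by simp [lin]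

/-- `DP S` splits off the factor at `k ∈ S`: `DP S = (X + k)·coP S k`. -/
theorem DP_eq {k : ℤ} (hk : k ∈ S) : DP S = lin k * coP S k := by
  unfold DP coP; rw [mul_comm, Finset.prod_erase_mul _ _ hk]

/-- The common denominator `DP S` is a non-zero polynomial. -/
theorem DP_ne_zero : DP S ≠ 0 :=
  Finset.prod_ne_zero_iff.2 fun j _ => X_add_C_ne_zero (j : ℚ)

/-- `DP S` vanishes at `−k` for `k ∈ S`. -/
theorem eval_DP_self {k₀ : ℤ} (hk0 : k₀ ∈ S) : (DP S).eval (-(k₀ : ℚ)) = 0 := by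
  unfold DP; rw [eval_prod]; exact Finset.prod_eq_zero hk0 (by rw [eval_lin]; ring)

/-- `coP S k` vanishes at `−j` for `j ∈ S`, `j ≠ k`. -/
theorem eval_coP_of_ne {k₀ k : ℤ} (hk0 : k₀ ∈ S) (hne : k ≠ k₀) : (coP S k).eval (-(k₀ : ℚ)) = 0 := by
  unfold coP; rw [eval_prod]
  exact Finset.prod_eq_zero (Finset.mem_erase.2 ⟨hne.symm, hk0⟩) (by rw [eval_lin]; ring)

/-- `coP S k` does not vanish at `−k` (the points of `S` are distinct). -/
theorem eval_coP_self_ne_zero (k : ℤ) : (coP S k).eval (-(k : ℚ)) ≠ 0 := by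
  unfold coP; rw [eval_prod]
  refine Finset.prod_ne_zero_iff.2 fun j hj h0 => ?_
  rw [eval_lin] at h0
  have hne : j ≠ k := (Finset.mem_erase.1 hj).1
  have : (j : ℚ) = k := by linarith
  exact hne (by exact_mod_cast this)

/-- `F = poly·D² + Σ α_k (X+k) coP_k² + Σ β_k coP_k²` — the data times `D²`, as a polynomial. -/
def FP (v : PF) : ℚ[X] :=
  v.poly * DP S ^ 2 + ∑ k ∈ S, C (v.simple k) * lin k * coP S k ^ 2 + ∑ k ∈ S, C (v.double k) * coP S k ^ 2

/-- `G = poly·D + Σ α_k coP_k` — the data times `D`, once the double parts are gone. -/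
def GP (v : PF) : ℚ[X] := v.poly * DP S + ∑ k ∈ S, C (v.simple k) * coP S k

/-- Off the poles, the cleared numerator `FP` evaluates to `DP(t)²·v(t)`. -/
theorem eval_FP (v : PF) (hS1 : v.simple.support ⊆ S) (hS2 : v.double.support ⊆ S) (t : ℚ)
    (ht : ∀ k ∈ S, t + k ≠ 0) : (FP S v).eval t = (DP S).eval t ^ 2 * v.eval t := by
  unfold FP PF.eval
  rw [Finsupp.sum_of_support_subset _ hS1 _ (fun _ _ => by simp),
    Finsupp.sum_of_support_subset _ hS2 _ (fun _ _ => by simp)]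
  simp_rw [eval_add, eval_finsetSum, eval_mul, eval_pow, eval_C, eval_lin]
  have e1 : ∀ k ∈ S, v.simple k * (t + k) * (coP S k).eval t ^ 2 = (DP S).eval t ^ 2 * (v.simple k / (t + k)) := by
    intro k hk
    rw [DP_eq S hk, eval_mul, eval_lin]
    field_simp [ht k hk]
  have e2 : ∀ k ∈ S, v.double k * (coP S k).eval t ^ 2 = (DP S).eval t ^ 2 * (v.double k / (t + k) ^ 2) := by
    intro k hk
    rw [DP_eq S hk, eval_mul, eval_lin]
    field_simp [ht k hk]
  rw [Finset.sum_congr rfl e1, Finset.sum_congr rfl e2, ← Finset.mul_sum, ← Finset.mul_sum]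
  ring

/-- If `v` vanishes off its poles then the cleared numerator `FP` is the zero polynomial (infinitely many roots). -/
theorem FP_eq_zero (v : PF) (hS1 : v.simple.support ⊆ S) (hS2 : v.double.support ⊆ S)
    (h : ∀ t : ℚ, (∀ k ∈ S, t + k ≠ 0) → v.eval t = 0) : FP S v = 0 := by
  apply Polynomial.eq_zero_of_infinite_isRoot
  have hfin : (↑(S.image fun k : ℤ => -(k : ℚ)) : Set ℚ).Finite := Finset.finite_toSet _
  refine hfin.infinite_compl.mono fun t ht => ?_
  have ht' : ∀ k ∈ S, t + k ≠ 0 := fun k hk h0 =>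
    ht (Finset.mem_coe.2 (Finset.mem_image.2 ⟨k, hk, by linarith⟩))
  show IsRoot (FP S v) t
  rw [IsRoot.def, eval_FP S v hS1 hS2 t ht', h t ht', mul_zero]

/-- Value of `FP` at a pole `−k`: only the double-pole term at `k` survives, `= β_k·coP(−k)²`. -/
theorem eval_FP_neg (v : PF) {k₀ : ℤ} (hk0 : k₀ ∈ S) :
    (FP S v).eval (-(k₀ : ℚ)) = v.double k₀ * (coP S k₀).eval (-(k₀ : ℚ)) ^ 2 := by
  unfold FP
  simp_rw [eval_add, eval_finsetSum, eval_mul, eval_pow, eval_C, eval_lin, eval_DP_self S hk0]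
  rw [Finset.sum_eq_single_of_mem k₀ hk0 (fun k _ hne => by rw [eval_coP_of_ne S hk0 hne]; ring),
    Finset.sum_eq_single_of_mem k₀ hk0 (fun k _ hne => by rw [eval_coP_of_ne S hk0 hne]; ring)]
  ring

/-- Value of the once-divided numerator `GP` at a pole `−k` (when all `β` vanish): `= α_k·coP(−k)·DP'`-free form. -/
theorem eval_GP_neg (v : PF) {k₀ : ℤ} (hk0 : k₀ ∈ S) :
    (GP S v).eval (-(k₀ : ℚ)) = v.simple k₀ * (coP S k₀).eval (-(k₀ : ℚ)) := by
  unfold GP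
  simp_rw [eval_add, eval_finsetSum, eval_mul, eval_C, eval_DP_self S hk0]
  rw [Finset.sum_eq_single_of_mem k₀ hk0 (fun k _ hne => by rw [eval_coP_of_ne S hk0 hne]; ring)]
  ring

/-- With no double parts, `FP = GP·DP`. -/
theorem GP_mul_DP (v : PF) (hβ : ∀ k ∈ S, v.double k = 0) : GP S v * DP S = FP S v := by
  unfold GP FP
  rw [Finset.sum_congr rfl (fun k hk => by rw [hβ k hk] :
      ∀ k ∈ S, C (v.double k) * coP S k ^ 2 = C 0 * coP S k ^ 2)]
  simp only [map_zero, zero_mul, Finset.sum_const_zero, add_zero]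
  rw [add_mul, Finset.sum_mul]
  congr 1
  · ring
  · refine Finset.sum_congr rfl fun k hk => ?_
    rw [DP_eq S hk]; ring

/-- **Lemma U** (partial-fraction uniqueness): data vanishing off a finite set are zero. -/
theorem PF.eq_zero_of_eval_eq_zero (v : PF) (S : Finset ℤ) (hS1 : v.simple.support ⊆ S)
    (hS2 : v.double.support ⊆ S) (h : ∀ t : ℚ, (∀ k ∈ S, t + k ≠ 0) → v.eval t = 0) :
    v.poly = 0 ∧ v.simple = 0 ∧ v.double = 0 := by
  have hF := FP_eq_zero S v hS1 hS2 h
  have hβS : ∀ k ∈ S, v.double k = 0 := fun k hk => by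
    have := eval_FP_neg S v hk
    rw [hF, eval_zero] at this
    exact (mul_eq_zero.1 this.symm).resolve_right (pow_ne_zero 2 (eval_coP_self_ne_zero S k))
  have hβ : v.double = 0 := by
    ext k
    by_cases hk : k ∈ S
    · exact hβS k hk
    · exact Finsupp.notMem_support_iff.1 fun hk' => hk (hS2 hk')
  have hG : GP S v = 0 := by
    have := GP_mul_DP S v hβS
    rw [hF] at this
    exact (mul_eq_zero.1 this).resolve_right (DP_ne_zero S)
  have hαS : ∀ k ∈ S, v.simple k = 0 := fun k hk => by
    have := eval_GP_neg S v hk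
    rw [hG, eval_zero] at this
    exact (mul_eq_zero.1 this.symm).resolve_right (eval_coP_self_ne_zero S k)
  have hα : v.simple = 0 := by
    ext k
    by_cases hk : k ∈ S
    · exact hαS k hk
    · exact Finsupp.notMem_support_iff.1 fun hk' => hk (hS1 hk')
  have hP : v.poly = 0 := by
    have hG' := hG
    unfold GP at hG'
    rw [Finset.sum_eq_zero (fun k hk => by rw [hαS k hk, map_zero, zero_mul]), add_zero] at hG'
    exact (mul_eq_zero.1 hG').resolve_right (DP_ne_zero S)
  exact ⟨hP, hα, hβ⟩

/-! ### Two data with the same values coincide -/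

/-- Evaluation is additive in the data (no side condition: junk values add up consistently). -/
theorem PF.eval_add (v w : PF) (t : ℚ) : (v.add w).eval t = v.eval t + w.eval t := by
  unfold PF.eval PF.add
  simp only
  rw [Polynomial.eval_add, Finsupp.sum_add_index' (fun _ => by simp) (fun _ _ _ => by ring),
    Finsupp.sum_add_index' (fun _ => by simp) (fun _ _ _ => by ring)]
  ring

/-- Evaluation is homogeneous in the data. -/
theorem PF.eval_smul (c : ℚ) (v : PF) (t : ℚ) : (v.smul c).eval t = c * v.eval t := by
  unfold PF.eval PF.smul
  simp only
  rw [Polynomial.eval_mul, eval_C, Finsupp.sum_smul_index' (fun _ => by simp),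
    Finsupp.sum_smul_index' (fun _ => by simp)]
  simp only [smul_eq_mul]
  unfold Finsupp.sum
  rw [mul_add, mul_add, Finset.mul_sum, Finset.mul_sum]
  congr 1
  · congr 1
    exact Finset.sum_congr rfl fun _ _ => by ring
  · exact Finset.sum_congr rfl fun _ _ => by ring

/-- **Lemma U, two-sided form**: the data of a rational function are unique. -/
theorem PF.eq_of_eval_eq (v w : PF) (S : Finset ℤ) (hv1 : v.simple.support ⊆ S) (hv2 : v.double.support ⊆ S)
    (hw1 : w.simple.support ⊆ S) (hw2 : w.double.support ⊆ S)
    (h : ∀ t : ℚ, (∀ k ∈ S, t + k ≠ 0) → v.eval t = w.eval t) :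
    v.poly = w.poly ∧ v.simple = w.simple ∧ v.double = w.double := by
  set u : PF := v.add (w.smul (-1)) with hu
  have hu1 : u.simple.support ⊆ S := by
    intro k hk
    have hk' := Finsupp.support_add hk
    rcases Finset.mem_union.1 hk' with h1 | h2
    · exact hv1 h1
    · exact hw1 (Finsupp.support_smul h2)
  have hu2 : u.double.support ⊆ S := by
    intro k hk
    have hk' := Finsupp.support_add hk
    rcases Finset.mem_union.1 hk' with h1 | h2
    · exact hv2 h1
    · exact hw2 (Finsupp.support_smul h2)
  have hu0 : ∀ t : ℚ, (∀ k ∈ S, t + k ≠ 0) → u.eval t = 0 := fun t ht => by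
    rw [hu, PF.eval_add, PF.eval_smul, h t ht]; ring
  obtain ⟨hp, hs, hd⟩ := PF.eq_zero_of_eval_eq_zero u S hu1 hu2 hu0
  refine ⟨?_, ?_, ?_⟩
  · have : v.poly + C (-1) * w.poly = 0 := hp
    rw [map_neg, map_one, neg_one_mul, add_neg_eq_zero] at this
    exact this
  · have : v.simple + (-1 : ℚ) • w.simple = 0 := hs
    rwa [neg_one_smul, add_neg_eq_zero] at this
  · have : v.double + (-1 : ℚ) • w.double = 0 := hd
    rwa [neg_one_smul, add_neg_eq_zero] at this

end Summit.KontsevichZagierPeriods.Zeta5Search.FormalBarnes
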